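import Summits.QuantumFields.YangMills.Theorems.ParabolicTrajectoryContinuumLimitOnTrajectoryUclMainA

/-!
# Crux `ContinuumLimitOnTrajectory` (stmt-QuantumFields-10522), line `two-orbit-synchronisation` (seat c2):
# the main term of the core clustering estimate

Helper file (`--supports stmt-QuantumFields-10522`) for the registered stub `stub_uclOfGap : UCLOfGap`, wave 2, worker
W2-MAIN. The registered anchor `main_term_bound`: under a torus OS gap `TorusOSGap r sch Δ'` and the OS-variance input
`VarBound r sch` (`…UclDefs`), the covariance of the lattice observables of the WINDOWED lower factor
`lowMain ρ_k s₀ Low` (times `[−ρ_k, s₀/4]`) and of the WINDOWED TRANSLATED upper factor `upMain ρ_k s₀ (T_{tb} Up)` (times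
`[3s₀/4, s₀ + ρ_k]`), `s₀ = t b₀`, is at most `ε` for all `t ≥ t₀`, eventually in `k`.

Proof (Osterwalder–Seiler 1978 §2; Glimm–Jaffe 1987 §6.1, §19.7): the covariance is the reflected, translated connected OS
pairing `osCorr μ_k Θ' τ_{m'} (Y, Z)` of the slab observables `Y = osLeft A (−α₂−2)`, `Z = osRight B (−α₂−2) m'`
(`cov_eq_osCorr`, `slabGood_osLeft_osRight`, `…UclSlab`; `A`, `B` the observables of the two pieces, reading the lattice
windows `[α₁, α₂]`, `[β₁ − 1, β₂]` by `readsTimes_obsOf`, `m' = β₁ − α₂ − 4 ≥ (s₀/2 − 3)/a_k`); the polarised slab gap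
(`norm_osCorr_slab_le_of_torusOSGap`, `…UclGap`) bounds it by `2 (osVar Y + osVar Z) e^{−Δ' a_k m'}`; the OS variances are at
most the plane-reflected self-pairings `∫ A conj (A ∘ planeRefl (α₂ + 2))`, `∫ B conj (B ∘ planeRefl (β₁ − 2))` (`…UclMainA`),
which `VarBound` bounds by `C (1 + |a_k T|)^κ |piece|²_{s''}`, polynomially in `t` (uniform cutoff bounds and
`schwartzNorm_translateMulti_le`); the exponential `e^{−Δ'(s₀/2 − 3)}` wins. The `∀ᶠ k` absorbs the thresholds of the gap and
of `VarBound`, `a_k (2R₀ + 4) ≤ 1`, and the geometry `s₀ + ρ_k + 2 ≤ a_k L_k / 8` (`ρ_k = √(a_k L_k) ≤ a_k L_k / 16`).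
-/

set_option autoImplicit false

open scoped SchwartzMap ComplexConjugate
open MeasureTheory Filter Topology Set
open Literature.MathematicalPhysics.QuantumFieldTheory Literature.MathematicalPhysics.QuantumLattice
open Literature.MathematicalPhysics.AQFT Literature.Probability.LatticeModels
open Summit.QuantumFields.YangMills.Cruxes.LatticeGapOnTrajectory.OrbitKantorovichFiniteSize.Transfer (TorusOSGap)

noncomputable section

namespace Summit.QuantumFields.YangMills.Cruxes.ContinuumLimitOnTrajectory.TwoOrbitSynchronisation

/-- **The main term of the core clustering estimate** (registered anchor, wave 2): under `TorusOSGap r sch Δ'` (`Δ' > 0`)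
and `VarBound r sch`, for locus-avoiding `Low`, `Up` and a translation vector `b` with `0 < b 0`: for every `ε > 0` there is
`t₀` such that for all `t ≥ t₀`, eventually in `k`,
`‖cD ((lowMain ρ_k s₀ Low) ⊗ (upMain ρ_k s₀ (T_{tb} Up))) − cD (lowMain ρ_k s₀ Low) · cD (upMain ρ_k s₀ (T_{tb} Up))‖ ≤ ε`,
`s₀ = t · b 0`, `ρ_k = rhoK sch k`. (`UUVB` and the locus-avoidance of the appended tensors are part of the registered
signature but not needed for the main term.) -/
theorem main_term_bound :
    ∀ {G : Type} [Group G] [TopologicalSpace G] [IsTopologicalGroup G] [CompactSpace G] [MeasurableSpace G] [BorelSpace G]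
      (r : LatticeRep G) (sch : SpeciesScheme (YMSpecies G)) (Δ' : ℝ), 0 < Δ' → TorusOSGap r sch Δ' → UUVB r sch →
      VarBound r sch →
      ∀ (n₁ n₂ : ℕ) (Low : 𝓢((Fin n₁ → EuclideanSpace ℝ (Fin 4)), ℂ)) (Up : 𝓢((Fin n₂ → EuclideanSpace ℝ (Fin 4)), ℂ))
        (b : EuclideanSpace ℝ (Fin 4)),
        AvoidsLocus Low → AvoidsLocus Up → 0 < b 0 →
        (∀ t : ℝ, AvoidsLocus (Low.appendTensor (translateMulti (t • b) Up))) →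
        ∀ ε : ℝ, 0 < ε → ∃ t₀ : ℝ, ∀ t : ℝ, t₀ ≤ t → ∀ᶠ k in atTop,
          ‖curvDistribution r sch k (n₁ + n₂) ((lowMain (rhoK sch k) (t * b 0) Low).appendTensor
                (upMain (rhoK sch k) (t * b 0) (translateMulti (t • b) Up))) -
              curvDistribution r sch k n₁ (lowMain (rhoK sch k) (t * b 0) Low) *
                curvDistribution r sch k n₂ (upMain (rhoK sch k) (t * b 0) (translateMulti (t • b) Up))‖ ≤ ε := by
  intro G _ _ _ _ _ _ r sch Δ' hΔ hgap _hU hVar n₁ n₂ Low Up b hLow hUp hb0 _hsep ε hε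
  /- constants independent of `t` and `k` -/
  obtain ⟨k₀, hk₀⟩ := norm_osCorr_slab_le_of_torusOSGap r sch hgap
  obtain ⟨s₁, κ₁, C₁, hC₁0, hV₁⟩ := hVar n₁
  obtain ⟨s₂, κ₂, C₂, hC₂0, hV₂⟩ := hVar n₂
  obtain ⟨K₁, hK₁0, hK₁⟩ := exists_bound_schwartzNorm_lowMain n₁ s₁
  obtain ⟨K₂, hK₂0, hK₂⟩ := exists_bound_schwartzNorm_upMain n₂ s₂
  have hnb : 0 ≤ ‖b‖ := norm_nonneg b
  have hc₀ : 0 < Δ' * b 0 / 2 := by positivity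
  set P₁ : ℝ := 2 * (C₁ * (b 0 + 3) ^ κ₁ * (K₁ * schwartzNorm s₁ Low) ^ 2) * Real.exp (3 * Δ') with hP₁
  set P₂ : ℝ := 2 * (C₂ * (b 0 + 3) ^ κ₂ * (K₂ * (2 * (1 + ‖b‖)) ^ s₂ * schwartzNorm s₂ Up) ^ 2) * Real.exp (3 * Δ')
    with hP₂
  /- the choice of `t₀`: exponential decay beats the polynomial growth of the two variance bounds -/
  have hE₁ : ∀ᶠ t in atTop, P₁ * (1 + t) ^ κ₁ * Real.exp (-(Δ' * b 0 / 2 * t)) ≤ ε / 2 :=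
    (tendsto_const_mul_pow_mul_exp_neg P₁ κ₁ hc₀).eventually_le_const (by linarith)
  have hE₂ : ∀ᶠ t in atTop, P₂ * (1 + t) ^ (κ₂ + 2 * s₂) * Real.exp (-(Δ' * b 0 / 2 * t)) ≤ ε / 2 :=
    (tendsto_const_mul_pow_mul_exp_neg P₂ (κ₂ + 2 * s₂) hc₀).eventually_le_const (by linarith)
  obtain ⟨t₀, ht₀⟩ :=
    eventually_atTop.1 (hE₁.and (hE₂.and ((eventually_ge_atTop 0).and (eventually_ge_atTop (6 / b 0)))))
  refine ⟨t₀, fun t ht => ?_⟩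
  obtain ⟨ht₁, ht₂, ht0, ht6⟩ := ht₀ t ht
  have htb : 0 ≤ t * b 0 := mul_nonneg ht0 hb0.le
  set s₀ : ℝ := t * b 0 with hs₀
  have hs₀6 : 6 ≤ s₀ := by rw [hs₀]; rwa [div_le_iff₀ hb0] at ht6
  /- eventually in `k`: gap threshold, the two `VarBound` thresholds, small spacing, large physical volume -/
  have hka : ∀ᶠ k in atTop, sch.a k * (2 * (timeRadius r.curvature : ℝ) + 4) ≤ 1 := by
    have hpos : (0 : ℝ) < 1 / (2 * (timeRadius r.curvature : ℝ) + 4) := by positivity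
    filter_upwards [sch.tendsto_a.eventually_lt_const hpos] with k hk
    rw [lt_div_iff₀ (by positivity)] at hk
    exact hk.le
  have hkL : ∀ᶠ k in atTop, max 256 (16 * (s₀ + 2)) ≤ sch.a k * sch.L k := tendsto_atTop.1 sch.tendsto_L _
  filter_upwards [eventually_ge_atTop k₀, hV₁, hV₂, hka, hkL] with k hk hV₁k hV₂k hak hLk
  have ha : 0 < sch.a k := sch.a_pos k
  have h256 : 256 ≤ sch.a k * sch.L k := (le_max_left _ _).trans hLk
  have hs₀L : 16 * (s₀ + 2) ≤ sch.a k * sch.L k := (le_max_right _ _).trans hLk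
  set ρ : ℝ := rhoK sch k with hρ
  have hρ0 : 0 ≤ ρ := Real.sqrt_nonneg _
  have hρL : ρ ≤ sch.a k * sch.L k / 16 := sqrt_le_div_sixteen h256
  have hgeom : s₀ + ρ + 2 ≤ sch.a k * sch.L k / 8 := by linarith
  /- the window arithmetic -/
  obtain ⟨m', w, hm', hwA, hwB, hmw, ham, ⟨hT0, hT1⟩, ⟨hT0', hT1'⟩⟩ := window_arith ha hak hs₀6 hρ0 hgeom
  /- the two pieces, their windows and locus-avoidance -/
  set LowM : 𝓢((Fin n₁ → EuclideanSpace ℝ (Fin 4)), ℂ) := lowMain ρ s₀ Low with hLowM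
  set UpM : 𝓢((Fin n₂ → EuclideanSpace ℝ (Fin 4)), ℂ) := upMain ρ s₀ (translateMulti (t • b) Up) with hUpM
  set θlo₁ : ℝ := -ρ - 1 with hθlo₁
  set θhi₁ : ℝ := s₀ / 4 + 1 with hθhi₁
  set θlo₂ : ℝ := 3 * s₀ / 4 - 1 with hθlo₂
  set θhi₂ : ℝ := s₀ + ρ + 1 with hθhi₂
  set α₁ : ℤ := ⌈θlo₁ / sch.a k⌉ - (timeRadius r.curvature : ℤ) with hα₁
  set α₂ : ℤ := ⌊θhi₁ / sch.a k⌋ + (timeRadius r.curvature : ℤ) with hα₂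
  set β₁ : ℤ := ⌈θlo₂ / sch.a k⌉ - (timeRadius r.curvature : ℤ) with hβ₁
  set β₂ : ℤ := ⌊θhi₂ / sch.a k⌋ + (timeRadius r.curvature : ℤ) with hβ₂
  have hsuppA : tsupport (LowM : (Fin n₁ → EuclideanSpace ℝ (Fin 4)) → ℂ) ⊆ {x | ∀ j, θlo₁ ≤ x j 0 ∧ x j 0 ≤ θhi₁} :=
    fun x hx => (tsupport_lowMain_subset ρ s₀ Low hx).2
  have hsuppB : tsupport (UpM : (Fin n₂ → EuclideanSpace ℝ (Fin 4)) → ℂ) ⊆ {x | ∀ j, θlo₂ ≤ x j 0 ∧ x j 0 ≤ θhi₂} :=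
    fun x hx => (tsupport_upMain_subset ρ s₀ _ hx).2
  have hAv : AvoidsLocus LowM := hLow.lowMain ρ s₀
  have hBv : AvoidsLocus UpM := (hUp.translateMulti (t • b)).upMain ρ s₀
  have hAr : ReadsTimes (obsOf r sch k n₁ LowM) α₁ α₂ := readsTimes_obsOf r sch k n₁ hsuppA
  have hBr : ReadsTimes (obsOf r sch k n₂ UpM) (β₁ - 1) β₂ :=
    (readsTimes_obsOf r sch k n₂ hsuppB).mono (by omega) le_rfl
  have hmwN : m' + 2 * w ≤ sch.L k := by exact_mod_cast hmw
  have hwside : w < sch.side k := by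
    show w < 2 * sch.L k + 1
    omega
  /- slab goodness of the OS observables and the OS form of the covariance -/
  obtain ⟨hY, hZ⟩ := slabGood_osLeft_osRight (measurable_obsOf r sch k n₁ LowM) (measurable_obsOf r sch k n₂ UpM)
    (exists_bound_obsOf r sch k n₁ LowM) (exists_bound_obsOf r sch k n₂ UpM) hAr hBr (m' := m') (w := w) hm' hwA hwB
    hwside
  have hgapk := hk₀ k hk w m' _ _ hY hZ hmwN
  rw [curvDistribution_appendTensor, curvDistribution_eq_integral_obsOf, curvDistribution_eq_integral_obsOf,
    cov_eq_osCorr r sch k (obsOf r sch k n₁ LowM) (obsOf r sch k n₂ UpM) (-α₂ - 2) m']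
  refine hgapk.trans ?_
  /- the two OS variances -/
  have hVY : osVar (μW r sch k) GaugeConfig.negReflect (osLeft sch k (obsOf r sch k n₁ LowM) (-α₂ - 2)) ≤
      C₁ * ((b 0 + 3) * (1 + t)) ^ κ₁ * (K₁ * schwartzNorm s₁ Low) ^ 2 := by
    refine (mainA_osVar_osLeft_le r sch k _ (-α₂ - 2)).trans ?_
    rw [show -(-α₂ - 2) = α₂ + 2 by ring]
    have h := hV₁k LowM (α₂ + 2) θlo₁ θhi₁ hAv hsuppA (Or.inl (by omega)) ?_ ?_ ?_
    · refine h.trans ?_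
      have h1 : 1 + |sch.a k * ((α₂ + 2 : ℤ) : ℝ)| ≤ (b 0 + 3) * (1 + t) := by
        push_cast
        rw [abs_of_nonneg hT0]
        linarith
      have h2 : schwartzNorm s₁ LowM ≤ K₁ * schwartzNorm s₁ Low := hK₁ ρ s₀ Low
      exact mul_le_mul (mul_le_mul_of_nonneg_left (pow_le_pow_left₀ (by positivity) h1 κ₁) hC₁0)
        (pow_le_pow_left₀ (schwartzNorm_nonneg _ _) h2 2) (by positivity) (by positivity)
    · rw [abs_le]; constructor <;> linarith
    · rw [abs_le]; constructor <;> linarith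
    · push_cast
      rw [abs_of_nonneg hT0]
      linarith
  have hVZ : osVar (μW r sch k) GaugeConfig.negReflect (osRight sch k (obsOf r sch k n₂ UpM) (-α₂ - 2) m') ≤
      C₂ * ((b 0 + 3) * (1 + t)) ^ κ₂ * (K₂ * ((2 * (1 + ‖b‖)) * (1 + t)) ^ s₂ * schwartzNorm s₂ Up) ^ 2 := by
    refine (mainA_osVar_osRight_le r sch k _ (-α₂ - 2) m').trans ?_
    rw [show (m' : ℤ) - (-α₂ - 2) = β₁ - 2 by omega]
    have h := hV₂k UpM (β₁ - 2) θlo₂ θhi₂ hBv hsuppB (Or.inr (by omega)) ?_ ?_ ?_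
    · refine h.trans ?_
      have h1 : 1 + |sch.a k * ((β₁ - 2 : ℤ) : ℝ)| ≤ (b 0 + 3) * (1 + t) := by
        push_cast
        rw [abs_of_nonneg hT0']
        linarith
      have h2 : schwartzNorm s₂ UpM ≤ K₂ * ((2 * (1 + ‖b‖)) * (1 + t)) ^ s₂ * schwartzNorm s₂ Up := by
        refine (hK₂ ρ s₀ _).trans ?_
        rw [mul_assoc]
        refine mul_le_mul_of_nonneg_left ?_ hK₂0
        refine (schwartzNorm_translateMulti_le s₂ (t • b) Up).trans ?_
        refine mul_le_mul_of_nonneg_right (pow_le_pow_left₀ (by positivity) ?_ s₂) (schwartzNorm_nonneg _ _)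
        rw [norm_smul, Real.norm_eq_abs, abs_of_nonneg ht0]
        have htn : 0 ≤ t * ‖b‖ := mul_nonneg ht0 hnb
        linarith
      exact mul_le_mul (mul_le_mul_of_nonneg_left (pow_le_pow_left₀ (by positivity) h1 κ₂) hC₂0)
        (pow_le_pow_left₀ (schwartzNorm_nonneg _ _) h2 2) (by positivity) (by positivity)
    · rw [abs_of_nonneg (by linarith)]; linarith
    · rw [abs_of_nonneg (by linarith)]; linarith
    · push_cast
      rw [abs_of_nonneg hT0']
      linarith
  /- the exponential -/
  have hexp : Real.exp (-Δ' * sch.a k * m') ≤ Real.exp (3 * Δ') * Real.exp (-(Δ' * b 0 / 2 * t)) := by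
    rw [← Real.exp_add]
    apply Real.exp_le_exp.2
    have ham' : t * b 0 / 2 - 3 ≤ sch.a k * m' := by rw [← hs₀]; exact ham
    have h := mul_le_mul_of_nonneg_left ham' hΔ.le
    linarith
  /- assembly -/
  calc _ ≤ 2 * (C₁ * ((b 0 + 3) * (1 + t)) ^ κ₁ * (K₁ * schwartzNorm s₁ Low) ^ 2 +
          C₂ * ((b 0 + 3) * (1 + t)) ^ κ₂ * (K₂ * ((2 * (1 + ‖b‖)) * (1 + t)) ^ s₂ * schwartzNorm s₂ Up) ^ 2) *
          (Real.exp (3 * Δ') * Real.exp (-(Δ' * b 0 / 2 * t))) :=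
        mul_le_mul (mul_le_mul_of_nonneg_left (add_le_add hVY hVZ) (by norm_num)) hexp (Real.exp_nonneg _)
          (by positivity)
    _ = P₁ * (1 + t) ^ κ₁ * Real.exp (-(Δ' * b 0 / 2 * t)) +
          P₂ * (1 + t) ^ (κ₂ + 2 * s₂) * Real.exp (-(Δ' * b 0 / 2 * t)) := by
        rw [hP₁, hP₂]
        generalize (1 + t) = X
        generalize (2 * (1 + ‖b‖)) = Y
        generalize (b 0 + 3) = W
        ring
    _ ≤ ε / 2 + ε / 2 := add_le_add ht₁ ht₂
    _ = ε := add_halves ε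

end Summit.QuantumFields.YangMills.Cruxes.ContinuumLimitOnTrajectory.TwoOrbitSynchronisation

end
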